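import Summits.QuantumFields.YangMills.Theorems.UniversalDetectorBlindMeshArzelaAscoli
import Summits.QuantumFields.YangMills.Theorems.UniversalDetectorBlindOrthantModulus
import Summits.QuantumFields.YangMills.Theorems.UniversalDetectorLatticeInvariance

/-!
# Route `UniversalDetector`, LINE «blind detector» (item stmt-QuantumFields-24148 `BlindDetector`, stub
# `BlindSeqExtraction`): blind extraction of a continuum kernel from lattice kernels, and the blind
# lattice-limit calculus off the coordinate hyperplanes

Fleet lead `ym-spine-19353-p1` g26 (crux `BalabanLadder.NT`, LINE g11-1 of ym-idea-8).  Lattice-indexed companions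
of `meshArzelaAscoliOn` (this seat) in the quantifier shape of the stub `BlindSeqExtraction` of
`Cruxes/NT/Lines/blind_detector.lean`, with the gauge `ρ z = minᵢ |zᵢ|` (distance to the coordinate hyperplanes):

* `coordGauge_*` — the gauge `z ↦ minᵢ |zᵢ|` on `ℝ⁴` is 1-Lipschitz, below the norm, positive exactly on
  `Ω = {z | ∀ i, zᵢ ≠ 0}`, and `η ≤ ρ (s z) ↔ ∀ i, η ≤ |s zᵢ|` on lattice points;
* **`blindLatticeKernel_extraction`** — spacings `s_k → 0⁺`, `s_k L_k → ∞`, kernels `g k` on `box 4 L_k` that are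
  eventually bounded off every `η`-ball (`hB`, the shape of the PROVED `HankelCeiling`) and eventually axis-Lipschitz
  on box segments off the `η`-ball whose moving coordinate stays outside the slab `|s z_k| < η` (`hAx`, the shape of
  the PROVED `HankelLongitudinal`): along a subsequence the kernels converge uniformly on the lattice points of every
  orthant annulus `Ω_η = {η ≤ |s zᵢ| ∀ i, ‖s z‖ ≤ η⁻¹}` to a kernel `K` that is measurable, continuous on `Ω`, zero off
  `Ω`, and bounded off every ball (orthant modulus `abs_sub_le_linearModulus` + `meshArzelaAscoliOn_indexed`);
* `eventually_mem_orthantAnnulus`, `tendsto_latticeValues_blind`, `latticeLimit_invariant_approx_blind` — the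
  lattice-limit calculus of `UniversalDetectorLatticeInvariance` with orthant annuli in place of annuli: evaluation
  of the limit along lattice sequences converging INTO `Ω`, and transport of approximate lattice symmetries
  (`K (σ x) = K x` for `x, σ x ∈ Ω`).

Pure analysis / lattice bookkeeping (abstract kernels `g k : Site 4 → ℝ`); no summit, rung or crux statement is
proved here. [folklore]
-/

set_option autoImplicit false

noncomputable section

namespace Summit.QuantumFields.YangMills.Cruxes.UniversalDetectorBlindExtraction

open Filter Topology Finset
open Literature.MathematicalPhysics.QuantumLattice (siteToE siteToE_apply)
open Literature.Probability.LatticeModels (Site box mem_box)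
open Summit.QuantumFields.YangMills.Cruxes.UniversalDetectorPlaneTight (latticeMesh_dense exists_latticeSeq_tendsto)

/-! ### The coordinate gauge `z ↦ minᵢ |zᵢ|` -/

/-- The coordinate gauge is attained. [folklore] -/
theorem exists_coordGauge_eq (z : EuclideanSpace ℝ (Fin 4)) :
    ∃ j : Fin 4, (univ : Finset (Fin 4)).inf' univ_nonempty (fun i => |z i|) = |z j| := by
  obtain ⟨j, -, hj⟩ := exists_mem_eq_inf' (s := (univ : Finset (Fin 4))) univ_nonempty (fun i => |z i|)
  exact ⟨j, hj⟩

/-- `η ≤ minᵢ |zᵢ| ↔ ∀ i, η ≤ |zᵢ|`. [folklore] -/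
theorem le_coordGauge_iff (η : ℝ) (z : EuclideanSpace ℝ (Fin 4)) :
    η ≤ (univ : Finset (Fin 4)).inf' univ_nonempty (fun i => |z i|) ↔ ∀ i : Fin 4, η ≤ |z i| := by
  rw [Finset.le_inf'_iff]; simp

/-- `0 < minᵢ |zᵢ| ↔ ∀ i, zᵢ ≠ 0`. [folklore] -/
theorem coordGauge_pos_iff (z : EuclideanSpace ℝ (Fin 4)) :
    0 < (univ : Finset (Fin 4)).inf' univ_nonempty (fun i => |z i|) ↔ ∀ i : Fin 4, z i ≠ 0 := by
  rw [Finset.lt_inf'_iff]; simp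

/-- The coordinate gauge is 1-Lipschitz. [folklore] -/
theorem abs_coordGauge_sub_le (x y : EuclideanSpace ℝ (Fin 4)) :
    |(univ : Finset (Fin 4)).inf' univ_nonempty (fun i => |x i|) -
        (univ : Finset (Fin 4)).inf' univ_nonempty (fun i => |y i|)| ≤ ‖x - y‖ := by
  have hc : ∀ (u v : EuclideanSpace ℝ (Fin 4)) (i : Fin 4), |u i| ≤ |v i| + ‖u - v‖ := by
    intro u v i
    have h1 : |(u - v) i| ≤ ‖u - v‖ := by
      simpa [Real.norm_eq_abs] using PiLp.norm_apply_le (u - v) i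
    have h2 : |u i| ≤ |v i| + |u i - v i| := by
      have := abs_sub_abs_le_abs_sub (u i) (v i); linarith
    rw [PiLp.sub_apply] at h1
    linarith
  have hle : ∀ (u v : EuclideanSpace ℝ (Fin 4)),
      (univ : Finset (Fin 4)).inf' univ_nonempty (fun i => |u i|) ≤
        (univ : Finset (Fin 4)).inf' univ_nonempty (fun i => |v i|) + ‖u - v‖ := by
    intro u v
    obtain ⟨j, hj⟩ := exists_coordGauge_eq v
    rw [hj]
    exact (inf'_le _ (mem_univ j)).trans (hc u v j)
  rw [abs_le]
  constructor
  · have h := hle y x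
    rw [norm_sub_rev] at h
    linarith
  · have h := hle x y; linarith

/-- The coordinate gauge is below the norm. [folklore] -/
theorem coordGauge_le_norm (z : EuclideanSpace ℝ (Fin 4)) :
    (univ : Finset (Fin 4)).inf' univ_nonempty (fun i => |z i|) ≤ ‖z‖ := by
  refine (inf'_le _ (mem_univ 0)).trans ?_
  simpa [Real.norm_eq_abs] using PiLp.norm_apply_le z 0

/-- On lattice points: `η ≤ ρ (s z) ↔ ∀ i, η ≤ |s zᵢ|`. [folklore] -/
theorem le_coordGauge_smul_siteToE_iff (η s : ℝ) (z : Site 4) :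
    η ≤ (univ : Finset (Fin 4)).inf' univ_nonempty (fun i => |(s • siteToE z) i|) ↔
      ∀ i : Fin 4, η ≤ |s * (z i : ℝ)| := by
  rw [le_coordGauge_iff]
  simp [siteToE_apply]

/-- `Ω = {∀ i, zᵢ ≠ 0}` is open. [folklore] -/
theorem isOpen_forall_coord_ne_zero : IsOpen {z : EuclideanSpace ℝ (Fin 4) | ∀ i : Fin 4, z i ≠ 0} := by
  have h : {z : EuclideanSpace ℝ (Fin 4) | ∀ i : Fin 4, z i ≠ 0} = ⋂ i : Fin 4, {z | z i ≠ 0} := by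
    ext z; simp
  rw [h]
  exact isOpen_iInter_of_finite fun i => isOpen_ne_fun (PiLp.continuous_apply 2 _ i) continuous_const

/-! ### Blind extraction of a continuum kernel -/

/-- **Blind diagonal extraction of a continuum kernel from lattice kernels.**  Spacings `s_k → 0⁺` with
`s_k L_k → ∞`; kernels `g k` on `box 4 L_k`, eventually uniformly bounded off every `η`-ball (`hB`) and eventually
axis-Lipschitz along box segments off the `η`-ball whose moving coordinate stays outside the slab `|s z_k| < η`
(`hAx`).  Then along a subsequence the kernels converge uniformly on the lattice points of every orthant annulus
`{η ≤ |s zᵢ| ∀ i, ‖s z‖ ≤ η⁻¹}` to a kernel `K` that is measurable, continuous on `Ω = {∀ i, zᵢ ≠ 0}`, zero off `Ω`,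
and bounded off every ball. [folklore] -/
theorem blindLatticeKernel_extraction (s : ℕ → ℝ) (L : ℕ → ℕ) (g : ℕ → Site 4 → ℝ) (hs : ∀ k, 0 < s k)
    (hs0 : Tendsto s atTop (𝓝 0)) (hL : Tendsto (fun k => s k * L k) atTop atTop)
    (hB : ∀ η : ℝ, 0 < η → ∃ (C : ℝ) (k₀ : ℕ), ∀ k, k₀ ≤ k → ∀ z ∈ box 4 (L k),
      η ≤ ‖s k • siteToE z‖ → |g k z| ≤ C)
    (hAx : ∀ η : ℝ, 0 < η → ∃ (Λ : ℝ) (k₀ : ℕ), ∀ k, k₀ ≤ k → ∀ (kk : Fin 4) (z : Site 4) (n : ℕ),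
      (∀ j : ℕ, j ≤ n → z + Pi.single kk (j : ℤ) ∈ box 4 (L k) ∧
        η ≤ ‖s k • siteToE (z + Pi.single kk (j : ℤ))‖ ∧ η ≤ |s k * ((z kk : ℝ) + j)|) →
      |g k z - g k (z + Pi.single kk (n : ℤ))| ≤ Λ * (s k * n)) :
    ∃ (φ : ℕ → ℕ) (K : EuclideanSpace ℝ (Fin 4) → ℝ), StrictMono φ ∧
      (∀ η ε : ℝ, 0 < η → 0 < ε → ∃ k₀ : ℕ, ∀ k : ℕ, k₀ ≤ k → ∀ z ∈ box 4 (L (φ k)),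
        (∀ i : Fin 4, η ≤ |s (φ k) * (z i : ℝ)|) → ‖s (φ k) • siteToE z‖ ≤ η⁻¹ →
          |g (φ k) z - K (s (φ k) • siteToE z)| ≤ ε) ∧
      Measurable K ∧ ContinuousOn K {z | ∀ i : Fin 4, z i ≠ 0} ∧
      (∀ z : EuclideanSpace ℝ (Fin 4), ¬ (∀ i : Fin 4, z i ≠ 0) → K z = 0) ∧
      (∀ η : ℝ, 0 < η → ∃ C : ℝ, ∀ z : EuclideanSpace ℝ (Fin 4), η ≤ ‖z‖ → |K z| ≤ C) := by
  have he : ∀ k, Set.InjOn (fun z : Site 4 => s k • siteToE z) (box 4 (L k) : Set (Site 4)) := by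
    intro k z _ z' _ hzz'
    have h := congrArg (fun v => (s k)⁻¹ • v) hzz'
    simp only [smul_smul, inv_mul_cancel₀ (hs k).ne', one_smul] at h
    funext i
    have hi := congrArg (fun v : EuclideanSpace ℝ (Fin 4) => v i) h
    simpa [siteToE_apply] using hi
  -- the orthant modulus: hypothesis `hM` of the blind mesh Arzelà–Ascoli for the coordinate gauge
  have hM : ∀ η : ℝ, 0 < η → ∃ (ω : ℝ → ℝ) (k₀ : ℕ), Tendsto ω (𝓝[>] 0) (𝓝 0) ∧
      ∀ k, k₀ ≤ k → ∀ z ∈ (box 4 (L k) : Set (Site 4)), ∀ z' ∈ (box 4 (L k) : Set (Site 4)),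
        η ≤ (univ : Finset (Fin 4)).inf' univ_nonempty (fun i => |(s k • siteToE z) i|) →
        η ≤ (univ : Finset (Fin 4)).inf' univ_nonempty (fun i => |(s k • siteToE z') i|) →
          |g k z - g k z'| ≤ ω ‖s k • siteToE z - s k • siteToE z'‖ := by
    intro η hη
    obtain ⟨C, k₁, hC⟩ := hB η hη
    obtain ⟨Λ, k₂, hΛ⟩ := hAx η hη
    refine ⟨fun t => (4 * max Λ 0 + max C 0 / η) * t, max k₁ k₂, ?_, ?_⟩
    · have hc : Continuous fun t : ℝ => (4 * max Λ 0 + max C 0 / η) * t := continuous_const.mul continuous_id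
      have h0 := hc.tendsto 0
      rw [mul_zero] at h0
      exact tendsto_nhdsWithin_of_tendsto_nhds h0
    · intro k hk z hz z' hz' hzη hz'η
      rw [le_coordGauge_smul_siteToE_iff] at hzη hz'η
      have hzb : z ∈ box 4 (L k) := Finset.mem_coe.1 hz
      have hz'b : z' ∈ box 4 (L k) := Finset.mem_coe.1 hz'
      refine abs_sub_le_linearModulus (hs k) hη (le_max_right _ _) (le_max_right _ _) (g k) ?_ ?_ z z' hzb hz'b
        hzη hz'η
      · intro kk w n hw
        exact (hΛ k ((le_max_right _ _).trans hk) kk w n hw).trans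
          (mul_le_mul_of_nonneg_right (le_max_left _ _) (by have := (hs k).le; positivity))
      · intro w hw hwη
        exact (hC k ((le_max_left _ _).trans hk) w hw ((hwη 0).trans (abs_smul_coord_le_norm _ w 0))).trans
          (le_max_left _ _)
  have hB' : ∀ η : ℝ, 0 < η → ∃ (C : ℝ) (k₀ : ℕ), ∀ k, k₀ ≤ k → ∀ z ∈ (box 4 (L k) : Set (Site 4)),
      η ≤ ‖s k • siteToE z‖ → |g k z| ≤ C := by
    intro η hη
    obtain ⟨C, k₀, hC⟩ := hB η hη
    exact ⟨C, k₀, fun k hk z hz hzη => hC k hk z (Finset.mem_coe.1 hz) hzη⟩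
  obtain ⟨φ, K, hφ, happ, hcont, hzero, hbd, hmeas⟩ := meshArzelaAscoliOn_indexed 4
    (fun z => (univ : Finset (Fin 4)).inf' univ_nonempty (fun i => |z i|)) abs_coordGauge_sub_le
    coordGauge_le_norm (fun k => (box 4 (L k) : Set (Site 4))) (fun k z => s k • siteToE z) g he hB' hM
    (latticeMesh_dense s L hs hs0 hL)
  have hΩ : {z : EuclideanSpace ℝ (Fin 4) | 0 < (univ : Finset (Fin 4)).inf' univ_nonempty (fun i => |z i|)} =
      {z | ∀ i : Fin 4, z i ≠ 0} := by
    ext z; exact coordGauge_pos_iff z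
  refine ⟨φ, K, hφ, fun η ε hη hε => ?_, hmeas, by rwa [hΩ] at hcont, fun z hz => hzero z ?_, hbd⟩
  · obtain ⟨k₀, hk₀⟩ := happ η ε hη hε
    refine ⟨k₀, fun k hk z hz hzη hzη' => hk₀ k hk z (Finset.mem_coe.2 hz) ?_ hzη'⟩
    exact (le_coordGauge_smul_siteToE_iff η (s (φ k)) z).2 hzη
  · rwa [coordGauge_pos_iff]

/-! ### The blind lattice-limit calculus (off the coordinate hyperplanes) -/

/-- A sequence converging to a point of `Ω` eventually lies in a fixed orthant annulus
`{η ≤ |uᵢ| ∀ i, ‖u‖ ≤ η⁻¹}`. [folklore] -/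
theorem eventually_mem_orthantAnnulus {x : EuclideanSpace ℝ (Fin 4)} (hx : ∀ i : Fin 4, x i ≠ 0)
    {u : ℕ → EuclideanSpace ℝ (Fin 4)} (hu : Tendsto u atTop (𝓝 x)) :
    ∃ η : ℝ, 0 < η ∧ ∀ᶠ k in atTop, (∀ i : Fin 4, η ≤ |u k i|) ∧ ‖u k‖ ≤ η⁻¹ := by
  set ρx : ℝ := (univ : Finset (Fin 4)).inf' univ_nonempty (fun i => |x i|) with hρx
  have hρpos : 0 < ρx := (coordGauge_pos_iff x).2 hx
  refine ⟨min (ρx / 2) (‖x‖ + 1)⁻¹, by positivity, ?_⟩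
  have hev : ∀ᶠ k in atTop, dist (u k) x < min (ρx / 2) 1 := Metric.tendsto_nhds.1 hu _ (by positivity)
  filter_upwards [hev] with k hk
  rw [dist_eq_norm] at hk
  have hk1 : ‖u k - x‖ < ρx / 2 := lt_of_lt_of_le hk (min_le_left _ _)
  have hk2 : ‖u k - x‖ < 1 := lt_of_lt_of_le hk (min_le_right _ _)
  constructor
  · intro i
    have hg : ρx - ‖x - u k‖ ≤ (univ : Finset (Fin 4)).inf' univ_nonempty (fun i => |u k i|) :=
      gauge_ge_of_near _ abs_coordGauge_sub_le x (u k)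
    rw [norm_sub_rev] at hg
    have h3 : (univ : Finset (Fin 4)).inf' univ_nonempty (fun i => |u k i|) ≤ |u k i| := inf'_le _ (mem_univ i)
    exact (min_le_left _ _).trans (by linarith)
  · have h2 : ‖u k‖ ≤ ‖x‖ + ‖u k - x‖ := by
      have := norm_add_le x (u k - x); rwa [add_sub_cancel] at this
    have h3 : ‖x‖ + 1 ≤ (min (ρx / 2) (‖x‖ + 1)⁻¹)⁻¹ := by
      rw [← inv_inv (‖x‖ + 1), inv_le_inv₀ (by positivity) (by positivity), inv_inv]
      exact min_le_right _ _
    linarith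

/-- **Evaluation of the blind lattice limit.**  Under the approximation clause on orthant annuli and continuity on
`Ω`, along any lattice sequence `s_{φ k} z_k → x ∈ Ω` (`z_k ∈ box` eventually) the kernel values converge to `K x`.
[folklore] -/
theorem tendsto_latticeValues_blind (s : ℕ → ℝ) (L : ℕ → ℕ) (g : ℕ → Site 4 → ℝ) (φ : ℕ → ℕ)
    (K : EuclideanSpace ℝ (Fin 4) → ℝ)
    (happrox : ∀ η ε : ℝ, 0 < η → 0 < ε → ∃ k₀ : ℕ, ∀ k : ℕ, k₀ ≤ k → ∀ z ∈ box 4 (L (φ k)),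
      (∀ i : Fin 4, η ≤ |s (φ k) * (z i : ℝ)|) → ‖s (φ k) • siteToE z‖ ≤ η⁻¹ →
        |g (φ k) z - K (s (φ k) • siteToE z)| ≤ ε)
    (hcont : ContinuousOn K {z | ∀ i : Fin 4, z i ≠ 0}) (x : EuclideanSpace ℝ (Fin 4))
    (hx : ∀ i : Fin 4, x i ≠ 0) (zs : ℕ → Site 4) (hzs : ∀ᶠ k in atTop, zs k ∈ box 4 (L (φ k)))
    (hzx : Tendsto (fun k => s (φ k) • siteToE (zs k)) atTop (𝓝 x)) :
    Tendsto (fun k => g (φ k) (zs k)) atTop (𝓝 (K x)) := by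
  obtain ⟨η, hη, hann⟩ := eventually_mem_orthantAnnulus hx hzx
  have hKz : Tendsto (fun k => K (s (φ k) • siteToE (zs k))) atTop (𝓝 (K x)) :=
    ((hcont x hx).continuousAt (isOpen_forall_coord_ne_zero.mem_nhds hx)).tendsto.comp hzx
  have hdiff : Tendsto (fun k => g (φ k) (zs k) - K (s (φ k) • siteToE (zs k))) atTop (𝓝 0) := by
    rw [Metric.tendsto_nhds]
    intro ε hε
    obtain ⟨k₀, hk₀⟩ := happrox η (ε / 2) hη (half_pos hε)
    filter_upwards [hann, hzs, eventually_ge_atTop k₀] with k hk hkz hk0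
    rw [dist_zero_right, Real.norm_eq_abs]
    refine (hk₀ k hk0 (zs k) hkz (fun i => ?_) hk.2).trans_lt (half_lt_self hε)
    have := hk.1 i
    simpa [siteToE_apply] using this
  have := hdiff.add hKz
  simpa using this

/-- **Approximate lattice symmetries pass to the blind limit kernel.**  Setting of `blindLatticeKernel_extraction`;
lattice maps `τ_k` which eventually preserve the box and intertwine a map `σ` of `ℝ⁴`, leaving the kernels invariant
up to a defect that tends to `0` uniformly on orthant annuli.  Then `K (σ x) = K x` whenever `x ∈ Ω`, `σ x ∈ Ω`
and `σ` is continuous at `x`. [folklore] -/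
theorem latticeLimit_invariant_approx_blind (s : ℕ → ℝ) (L : ℕ → ℕ) (g : ℕ → Site 4 → ℝ)
    (hs : ∀ k, 0 < s k) (hs0 : Tendsto s atTop (𝓝 0)) (hL : Tendsto (fun k => s k * L k) atTop atTop)
    (φ : ℕ → ℕ) (hφ : StrictMono φ) (K : EuclideanSpace ℝ (Fin 4) → ℝ)
    (happrox : ∀ η ε : ℝ, 0 < η → 0 < ε → ∃ k₀ : ℕ, ∀ k : ℕ, k₀ ≤ k → ∀ z ∈ box 4 (L (φ k)),
      (∀ i : Fin 4, η ≤ |s (φ k) * (z i : ℝ)|) → ‖s (φ k) • siteToE z‖ ≤ η⁻¹ →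
        |g (φ k) z - K (s (φ k) • siteToE z)| ≤ ε)
    (hcont : ContinuousOn K {z | ∀ i : Fin 4, z i ≠ 0})
    (τ : ℕ → Site 4 → Site 4) (σ : EuclideanSpace ℝ (Fin 4) → EuclideanSpace ℝ (Fin 4))
    (hτ : ∀ᶠ k in atTop, ∀ z ∈ box 4 (L (φ k)),
      τ k z ∈ box 4 (L (φ k)) ∧ s (φ k) • siteToE (τ k z) = σ (s (φ k) • siteToE z))
    (hinv : ∀ η ε : ℝ, 0 < η → 0 < ε → ∀ᶠ k in atTop, ∀ z ∈ box 4 (L (φ k)),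
      (∀ i : Fin 4, η ≤ |s (φ k) * (z i : ℝ)|) → ‖s (φ k) • siteToE z‖ ≤ η⁻¹ → |g (φ k) (τ k z) - g (φ k) z| ≤ ε)
    (x : EuclideanSpace ℝ (Fin 4)) (hx : ∀ i : Fin 4, x i ≠ 0) (hσx : ∀ i : Fin 4, σ x i ≠ 0)
    (hσc : ContinuousAt σ x) :
    K (σ x) = K x := by
  obtain ⟨zs, hzs, hzx⟩ := exists_latticeSeq_tendsto s L hs hs0 hL φ hφ x
  have h1 : Tendsto (fun k => g (φ k) (zs k)) atTop (𝓝 (K x)) :=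
    tendsto_latticeValues_blind s L g φ K happrox hcont x hx zs hzs hzx
  have hτzs : ∀ᶠ k in atTop, τ k (zs k) ∈ box 4 (L (φ k)) ∧
      s (φ k) • siteToE (τ k (zs k)) = σ (s (φ k) • siteToE (zs k)) := by
    filter_upwards [hzs, hτ] with k hk hτk using hτk _ hk
  have h2 : Tendsto (fun k => g (φ k) (τ k (zs k))) atTop (𝓝 (K (σ x))) := by
    refine tendsto_latticeValues_blind s L g φ K happrox hcont (σ x) hσx (fun k => τ k (zs k))
      (hτzs.mono fun k hk => hk.1) ?_
    exact (hσc.tendsto.comp hzx).congr' (by filter_upwards [hτzs] with k hk using hk.2.symm)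
  have h3 : Tendsto (fun k => g (φ k) (τ k (zs k)) - g (φ k) (zs k)) atTop (𝓝 0) := by
    obtain ⟨η, hη, hann⟩ := eventually_mem_orthantAnnulus hx hzx
    rw [Metric.tendsto_nhds]
    intro ε hε
    filter_upwards [hann, hzs, hinv η (ε / 2) hη (half_pos hε)] with k hk hkz hkinv
    rw [dist_zero_right, Real.norm_eq_abs]
    refine (hkinv (zs k) hkz (fun i => ?_) hk.2).trans_lt (half_lt_self hε)
    have := hk.1 i
    simpa [siteToE_apply] using this
  have h4 : Tendsto (fun k => g (φ k) (τ k (zs k))) atTop (𝓝 (0 + K x)) := by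
    have := h3.add h1
    simpa only [sub_add_cancel] using this
  rw [zero_add] at h4
  exact tendsto_nhds_unique h2 h4

end Summit.QuantumFields.YangMills.Cruxes.UniversalDetectorBlindExtraction

end
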